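import Summits.QuantumAdvantage.QuantumAdvantage.Theorems.WalkThreeStepThreeWeights

/-!
# Rung (G♯₂) `ThreeStepFreeRungFive` (item stmt-QuantumAdvantage-23286), architecture (U): the THREE-WEIGHTS LAW FROM SYMMETRY AND
# NEAR READS ONLY (no window locality)

Cell qa-qnc0, route OddPrimeWalk, support item stmt-QuantumAdvantage-23286; prover qn-prover-3 g16.

A second form of module U-d with WEAKER hypotheses, designed for the assembly: instead of `LocalOrBlind` (every cut an R-local window cut
or block-blind) we assume only
* (SYM) the register is invariant under the transpositions strictly inside `[a, a+L)` — supplied UNCONDITIONALLY on hub-free degenerate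
  intervals by `reg_cornerFlip_free` (`WalkThreeStepFreeSymmetry`), and
* (NEAR) `NearReads S R a L`: every read of a cut that carries a non-zero coefficient (`coefS`, `coefM` — the effective coefficients of
  `N(s)` and `N(max s t)` in the three-step form) and lands strictly inside `(a, a+L)` lies within `R` of the cut's own position.
  X-type cuts, absolute counters, `W mod p` readers, far reads OUTSIDE the interval are all allowed; (NEAR) is exactly the conclusion of the
  planner's FAR-READ LEMMA (U-c1), so with this file the assembly of (U) needs U-c1 only (no XSparsity, no `LocalModW`).
Results: `increment_homog_far`, `increment_law_far`, **`threeWeights_law_far`**, `reg_fillBlock_period_far`, `win_fillBlock_period_far`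
(same conclusions as 5/5).  Proof of the increment step: a cut positioned below `a + C + v + p + R` neither sees the far segment
`F⋆ = [b, b+p)`, `b = a + C + v + 2p + 2R`, nor has its label moved by it (its two terms cancel); a cut positioned above has all its
effective reads above the near segment `F₁ = [a+C+v, a+C+v+p)`, so adding `F₁` multiplies both its terms by `ζ^p` (`y_congr_coef`).
WHAT THIS IS NOT: not the item (U-c1 and the assembly remain); separation NOT moved.
-/

namespace Summit.QuantumAdvantage.AdviceFreeQNC0.LocalEngine

open Finset Classical

namespace RungU

variable {p n : ℕ}

/-! ### §1 Effective coefficients of the two reads; near reads -/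

/-- the coefficient of `N(s)` in the form of cut `g`: `α − β` if `s < t`, else `α − γ`. -/
def coefS (S : ThreeStep p n) (g : Fin (n + 1)) : ZMod p := if S.s g < S.t g then S.α g - S.β g else S.α g - S.γ g

/-- the coefficient of `N(max s t)` in the form of cut `g`: `β − γ` if `s < t`, else `0`. -/
def coefM (S : ThreeStep p n) (g : Fin (n + 1)) : ZMod p := if S.s g < S.t g then S.β g - S.γ g else 0

/-- the fire bit in coefficient form: `J_g = [coefS·N(s) + coefM·N(max s t) + γ·W = r]`. -/
theorem y_eq_decide_coef (S : ThreeStep p n) (g : Fin (n + 1)) (x : Fin n → Bool) :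
    S.y g x = decide (coefS S g * ((wtPrefix x (S.s g) : ℕ) : ZMod p)
      + coefM S g * ((wtPrefix x (max (S.s g) (S.t g)) : ℕ) : ZMod p) + S.γ g * ((wt x : ℕ) : ZMod p) = S.r g) := by
  rw [ThreeStep.y_eq_decide]
  unfold coefS coefM
  by_cases h : S.s g < S.t g
  · rw [if_pos h, if_pos h]
    congr 1
    apply propext
    constructor <;> intro e <;> linear_combination e
  · rw [if_neg h, if_neg h, max_eq_left (Nat.le_of_not_lt h)]
    congr 1
    apply propext
    constructor <;> intro e <;> linear_combination e

/-- **fire bits agree when the EFFECTIVE reads keep their residues**: a read with zero coefficient may change arbitrarily. -/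
theorem y_congr_coef (S : ThreeStep p n) (g : Fin (n + 1)) {x x' : Fin n → Bool}
    (h1 : coefS S g = 0 ∨ wtPrefix x (S.s g) % p = wtPrefix x' (S.s g) % p)
    (h2 : coefM S g = 0 ∨ wtPrefix x (max (S.s g) (S.t g)) % p = wtPrefix x' (max (S.s g) (S.t g)) % p)
    (h3 : wt x % p = wt x' % p) : S.y g x = S.y g x' := by
  rw [y_eq_decide_coef, y_eq_decide_coef, (ZMod.natCast_eq_natCast_iff' _ _ _).mpr h3]
  have e1 : coefS S g * ((wtPrefix x (S.s g) : ℕ) : ZMod p) = coefS S g * ((wtPrefix x' (S.s g) : ℕ) : ZMod p) := by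
    rcases h1 with h | h
    · rw [h, zero_mul, zero_mul]
    · rw [(ZMod.natCast_eq_natCast_iff' _ _ _).mpr h]
  have e2 : coefM S g * ((wtPrefix x (max (S.s g) (S.t g)) : ℕ) : ZMod p)
      = coefM S g * ((wtPrefix x' (max (S.s g) (S.t g)) : ℕ) : ZMod p) := by
    rcases h2 with h | h
    · rw [h, zero_mul, zero_mul]
    · rw [(ZMod.natCast_eq_natCast_iff' _ _ _).mpr h]
  rw [e1, e2]

/-- **(NEAR)**: every effective read landing strictly inside `(a, a+L)` is within `R` of the cut's position (the conclusion of the far-read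
lemma U-c1; far reads outside the interval, zero-coefficient reads and `W mod p` are unconstrained). -/
def NearReads (S : ThreeStep p n) (R a L : ℕ) : Prop :=
  ∀ g : Fin (n + 1),
    (coefS S g ≠ 0 → a < S.s g → S.s g < a + L → g.val ≤ S.s g + R ∧ S.s g ≤ g.val + R) ∧
    (coefM S g ≠ 0 → a < max (S.s g) (S.t g) → max (S.s g) (S.t g) < a + L →
      g.val ≤ max (S.s g) (S.t g) + R ∧ max (S.s g) (S.t g) ≤ g.val + R)

/-- **(SYM)**: the register is invariant under the transpositions strictly inside `[a, a+L)`. -/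
def RegSym (S : ThreeStep p n) (a L : ℕ) : Prop :=
  ∀ k, a + 1 ≤ k → k < a + L → ∀ x : Fin n → Bool, reg S (cornerFlip n k x) = reg S x

/-! ### §2 Increment homogeneity from (NEAR) -/

section Increment

variable (S : ThreeStep p n) {a L R C v : ℕ} (u : Fin n → Bool)

/-- adding a segment of `p` ones strictly inside `(a, a+L)` does not change the fire bit of a cut whose effective reads are not strictly
inside the segment. -/
theorem y_flipOn_seg_of_reads (hnear : NearReads S R a L) {lo : ℕ} (hlo : a ≤ lo) (hhi : lo + p ≤ a + L) (hn : a + L ≤ n)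
    (y : Fin n → Bool) (hy : ∀ i ∈ (seg lo p : Finset (Fin n)), y i = false) (g : Fin (n + 1))
    (hg : g.val + R ≤ lo ∨ lo + p + R ≤ g.val) : S.y g (flipOn (seg lo p) y) = S.y g y := by
  have res : ∀ r, ¬ (lo < r ∧ r < lo + p) → wtPrefix (flipOn (seg lo p) y) r % p = wtPrefix y r % p := by
    intro r hr
    rw [wtPrefix_flipOn_false _ y hy r]
    by_cases h1 : r ≤ lo
    · rw [card_seg_filter_of_le h1, add_zero]
    · rw [card_seg_filter_of_ge (by omega) (by omega), Nat.add_mod_right]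
  apply y_congr_coef S g
  · by_cases hc : coefS S g = 0
    · exact Or.inl hc
    · right; apply res; intro hh
      have := (hnear g).1 hc (by omega) (by omega)
      omega
  · by_cases hc : coefM S g = 0
    · exact Or.inl hc
    · right; apply res; intro hh
      have := (hnear g).2 hc (by omega) (by omega)
      omega
  · rw [Coset21.wt_eq_wtPrefix, Coset21.wt_eq_wtPrefix, wtPrefix_flipOn_false _ y hy n,
      card_seg_filter_of_ge (by omega) (by omega), Nat.add_mod_right]

/-- **INCREMENT HOMOGENEITY from (NEAR)**: with `b = a + C + v + 2p + 2R`,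
`Ŵ(B_{v+p} ∪ F⋆) + Ŵ(B_{v+p}) = ζ^p · (Ŵ(B_v ∪ F⋆) + Ŵ(B_v))`, `F⋆ = [b, b+p)`. -/
theorem increment_homog_far (hnear : NearReads S R a L) (hL : C + v + 3 * p + 2 * R ≤ L) (hn : a + L ≤ n) :
    reg S (flipOn (seg (a + C + v + 2 * p + 2 * R) p) (fillBlock u a L C (v + p))) + reg S (fillBlock u a L C (v + p))
      = rotZ ((p : ℕ) : ZMod 3)
          (reg S (flipOn (seg (a + C + v + 2 * p + 2 * R) p) (fillBlock u a L C v)) + reg S (fillBlock u a L C v)) := by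
  set b := a + C + v + 2 * p + 2 * R with hb
  set B0 := fillBlock u a L C v with hB0
  set B1 := fillBlock u a L C (v + p) with hB1
  set F1 : Finset (Fin n) := seg (a + C + v) p with hF1
  set Fs : Finset (Fin n) := seg b p with hFs
  have hB1e : B1 = flipOn F1 B0 := by rw [hB1, hB0, hF1]; exact fillBlock_add u a L C v p (by omega)
  have zB0F1 : ∀ i ∈ F1, B0 i = false := fun i hi => by
    rw [hF1, mem_seg] at hi; exact fillBlock_false u i (by omega) (by omega)
  have zB0Fs : ∀ i ∈ Fs, B0 i = false := fun i hi => by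
    rw [hFs, mem_seg] at hi; exact fillBlock_false u i (by omega) (by omega)
  have zB1Fs : ∀ i ∈ Fs, B1 i = false := fun i hi => by
    rw [hFs, mem_seg] at hi; exact fillBlock_false u i (by omega) (by omega)
  have zT0F1 : ∀ i ∈ F1, flipOn Fs B0 i = false := fun i hi => by
    have hi' := hi
    rw [hF1, mem_seg] at hi'
    rw [flipOn_of_not_mem (fun h => by rw [hFs, mem_seg] at h; omega)]
    exact zB0F1 i hi
  have hT1e : flipOn Fs B1 = flipOn F1 (flipOn Fs B0) := by
    rw [hB1e]; funext i; unfold flipOn; by_cases h1 : i ∈ Fs <;> by_cases h2 : i ∈ F1 <;> simp [h1, h2]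
  -- termwise: low cuts cancel, high cuts rotate
  unfold reg
  rw [← Finset.sum_add_distrib, ← Finset.sum_add_distrib, rotZ_sum]
  apply Finset.sum_congr rfl
  intro g _
  by_cases hlow : g.val + R ≤ a + C + v + 2 * p + 2 * R
  · -- g + R ≤ b: the far segment is invisible to g and does not move its label
    have hgb : g.val + R ≤ b := by omega
    have e1 : term S (flipOn Fs B1) g = term S B1 g := by
      apply term_congr S g
      · rw [hFs]; exact y_flipOn_seg_of_reads S hnear (by omega) (by omega) hn B1 zB1Fs g (Or.inl (by omega))
      · rw [wtPrefix_flipOn_false Fs B1 zB1Fs g.val, hFs, card_seg_filter_of_le (by omega), add_zero]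
    have e0 : term S (flipOn Fs B0) g = term S B0 g := by
      apply term_congr S g
      · rw [hFs]; exact y_flipOn_seg_of_reads S hnear (by omega) (by omega) hn B0 zB0Fs g (Or.inl (by omega))
      · rw [wtPrefix_flipOn_false Fs B0 zB0Fs g.val, hFs, card_seg_filter_of_le (by omega), add_zero]
    rw [e1, e0, F4_add_self, F4_add_self, rotZ_map_zero]
  · -- g ≥ a + C + v + p + R: the near segment lies below all of g's effective reads; both terms rotate
    have hghi : a + C + v + p + R ≤ g.val := by omega
    have r1 : term S B1 g = rotZ ((p : ℕ) : ZMod 3) (term S B0 g) := by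
      rw [hB1e]
      apply term_shift S g p
      · rw [hF1]; exact y_flipOn_seg_of_reads S hnear (by omega) (by omega) hn B0 zB0F1 g (Or.inr (by omega))
      · rw [wtPrefix_flipOn_false F1 B0 zB0F1 g.val, hF1, card_seg_filter_of_ge (by omega) (by omega)]
    have r2 : term S (flipOn Fs B1) g = rotZ ((p : ℕ) : ZMod 3) (term S (flipOn Fs B0) g) := by
      rw [hT1e]
      apply term_shift S g p
      · rw [hF1]; exact y_flipOn_seg_of_reads S hnear (by omega) (by omega) hn _ zT0F1 g (Or.inr (by omega))
      · rw [wtPrefix_flipOn_false F1 _ zT0F1 g.val, hF1, card_seg_filter_of_ge (by omega) (by omega)]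
    rw [r1, r2, rotZ_map_add]

end Increment

/-! ### §3 The increment law, the three-weights law and the period `3p` from (SYM) + (NEAR) -/

/-- **THE INCREMENT LAW from (SYM) + (NEAR)**: `Ŵ(v+2p) + Ŵ(v+p) = ζ^p (Ŵ(v+p) + Ŵ(v))` for the block inputs. -/
theorem increment_law_far (S : ThreeStep p n) {a L R C v : ℕ} (hsym : RegSym S a L) (hnear : NearReads S R a L)
    (hn : a + L ≤ n) (hL : C + v + 3 * p + 2 * R ≤ L) (u : Fin n → Bool) :
    reg S (fillBlock u a L C (v + 2 * p)) + reg S (fillBlock u a L C (v + p))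
      = rotZ ((p : ℕ) : ZMod 3) (reg S (fillBlock u a L C (v + p)) + reg S (fillBlock u a L C v)) := by
  set b := a + C + v + 2 * p + 2 * R with hb
  set B0 := fillBlock u a L C v with hB0
  set B1 := fillBlock u a L C (v + p) with hB1
  set B2 := fillBlock u a L C (v + 2 * p) with hB2
  set Fs : Finset (Fin n) := seg b p with hFs
  have hsym' : ∀ x x' : Fin n → Bool, (∀ i : Fin n, i.val < a ∨ a + L ≤ i.val → x i = x' i) →
      cnt x a (a + L) = cnt x' a (a + L) → reg S x = reg S x' :=
    swap_connect (reg S) a (a + L) (fun k h1 h2 y => hsym k (by omega) h2 y)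
  have hB1e : B1 = flipOn (seg (a + C + v) p) B0 := fillBlock_add u a L C v p (by omega)
  have hB2e : B2 = flipOn (seg (a + C + v + p) p) B1 := by
    rw [hB2, hB1, show v + 2 * p = (v + p) + p by ring, show a + C + v + p = a + C + (v + p) by ring]
    exact fillBlock_add u a L C (v + p) p (by omega)
  have zB0 : ∀ i ∈ (seg (a + C + v) p : Finset (Fin n)), B0 i = false := fun i hi => by
    rw [mem_seg] at hi; exact fillBlock_false u i (by omega) (by omega)
  have zB1 : ∀ i ∈ (seg (a + C + v + p) p : Finset (Fin n)), B1 i = false := fun i hi => by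
    rw [mem_seg] at hi; exact fillBlock_false u i (by omega) (by omega)
  have zB0s : ∀ i ∈ Fs, B0 i = false := fun i hi => by
    rw [hFs, mem_seg] at hi; exact fillBlock_false u i (by omega) (by omega)
  have zB1s : ∀ i ∈ Fs, B1 i = false := fun i hi => by
    rw [hFs, mem_seg] at hi; exact fillBlock_false u i (by omega) (by omega)
  have outF : ∀ (y : Fin n → Bool) (lo len : ℕ), a ≤ lo → lo + len ≤ a + L →
      ∀ i : Fin n, i.val < a ∨ a + L ≤ i.val → flipOn (seg lo len) y i = y i := by
    intro y lo len h1 h2 i hi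
    apply flipOn_of_not_mem; intro h; rw [mem_seg] at h; omega
  have e1 : reg S B1 = reg S (flipOn Fs B0) := by
    apply hsym'
    · intro i hi; rw [hB1e, outF B0 _ _ (by omega) (by omega) i hi, outF B0 _ _ (by omega) (by omega) i hi]
    · rw [hB1e, cnt_flipOn_seg B0 (by omega) (by omega) hn zB0, hFs, cnt_flipOn_seg B0 (by omega) (by omega) hn zB0s]
  have e2 : reg S B2 = reg S (flipOn Fs B1) := by
    apply hsym'
    · intro i hi; rw [hB2e, outF B1 _ _ (by omega) (by omega) i hi, outF B1 _ _ (by omega) (by omega) i hi]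
    · rw [hB2e, cnt_flipOn_seg B1 (by omega) (by omega) hn zB1, hFs, cnt_flipOn_seg B1 (by omega) (by omega) hn zB1s]
  have hinc := increment_homog_far S u hnear hL hn
  rw [← hFs, ← hB0, ← hB1, ← e1, ← e2] at hinc
  exact hinc

/-- **THE THREE-WEIGHTS LAW from (SYM) + (NEAR).** -/
theorem threeWeights_law_far (hp : 1 ≤ p) (hp3 : p % 3 ≠ 0) (c : ℕ) (S : ThreeStep p n) {a L R C v : ℕ}
    (hsym : RegSym S a L) (hnear : NearReads S R a L) (hn : a + L ≤ n) (hL : C + v + 3 * p + 2 * R ≤ L) (u : Fin n → Bool) :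
    ¬ (ringWinU c S.y (fillBlock u a L C v) = true ∧ ringWinU c S.y (fillBlock u a L C (v + p)) = true ∧
       ringWinU c S.y (fillBlock u a L C (v + 2 * p)) = true) := by
  have hinc := increment_law_far S hsym hnear hn hL u
  have w1 : wt (fillBlock u a L C (v + p)) = wt (fillBlock u a L C v) + p := wt_fillBlock_add u (by omega) hn
  have w2 : wt (fillBlock u a L C (v + 2 * p)) = wt (fillBlock u a L C v) + p + p := by
    rw [show v + 2 * p = v + (p + p) by ring, wt_fillBlock_add u (by omega) hn]; ring
  rw [ringWinU_iff_ev, ringWinU_iff_ev, ringWinU_iff_ev, w2, w1]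
  have t1 : ((c + (wt (fillBlock u a L C v) + p) : ℕ) : ZMod 3) = ((c + wt (fillBlock u a L C v) : ℕ) : ZMod 3) + (p : ℕ) := by
    push_cast; ring
  have t2 : ((c + (wt (fillBlock u a L C v) + p + p) : ℕ) : ZMod 3)
      = ((c + wt (fillBlock u a L C v) : ℕ) : ZMod 3) + (p : ℕ) + (p : ℕ) := by
    push_cast; ring
  rw [t1, t2]
  exact not_three_ones' _ _ _ _ _ (cast_p_ne_zero hp3) hinc

/-- **PERIOD `3p` from (SYM) + (NEAR)**: the register of the block input is `3p`-periodic in the block weight. -/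
theorem reg_fillBlock_period_far (hp : 1 ≤ p) (hp3 : p % 3 ≠ 0) (S : ThreeStep p n) {a L R C v : ℕ}
    (hsym : RegSym S a L) (hnear : NearReads S R a L) (hn : a + L ≤ n) (hL : C + v + 4 * p + 2 * R ≤ L) (u : Fin n → Bool) :
    reg S (fillBlock u a L C (v + 3 * p)) = reg S (fillBlock u a L C v) := by
  have h1 := increment_law_far S hsym hnear hn (C := C) (v := v) (by omega) u
  have h2 := increment_law_far S hsym hnear hn (C := C) (v := v + p) (by omega) u
  rw [show v + p + 2 * p = v + 3 * p by ring, show v + p + p = v + 2 * p by ring, h1, ← rotZ_add] at h2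
  have key : ∀ (s : ZMod 3) (A₀ A₁ A₂ A₃ : F4), s ≠ 0 → A₂ + A₁ = rotZ s (A₁ + A₀) → A₃ + A₂ = rotZ (s + s) (A₁ + A₀) →
      A₃ = A₀ := by
    decide
  have _ := hp
  exact key _ _ _ _ _ (cast_p_ne_zero hp3) h1 h2

/-- Hence **WIN is `3p`-periodic in the block weight** from (SYM) + (NEAR). -/
theorem win_fillBlock_period_far (hp : 1 ≤ p) (hp3 : p % 3 ≠ 0) (c : ℕ) (S : ThreeStep p n) {a L R C v : ℕ}
    (hsym : RegSym S a L) (hnear : NearReads S R a L) (hn : a + L ≤ n) (hL : C + v + 4 * p + 2 * R ≤ L) (u : Fin n → Bool) :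
    ringWinU c S.y (fillBlock u a L C (v + 3 * p)) = ringWinU c S.y (fillBlock u a L C v) := by
  have hr := reg_fillBlock_period_far hp hp3 S hsym hnear hn hL u
  have hw : wt (fillBlock u a L C (v + 3 * p)) = wt (fillBlock u a L C v) + 3 * p := wt_fillBlock_add u (by omega) (by omega)
  have ht : ((c + wt (fillBlock u a L C (v + 3 * p)) : ℕ) : ZMod 3) = ((c + wt (fillBlock u a L C v) : ℕ) : ZMod 3) := by
    rw [hw]
    push_cast
    have : (3 : ZMod 3) = 0 := by decide
    rw [this, zero_mul, add_zero]
  rw [Bool.eq_iff_iff, ringWinU_iff_ev, ringWinU_iff_ev, hr, ht]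

end RungU

end Summit.QuantumAdvantage.AdviceFreeQNC0.LocalEngine
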